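import Summits.QuantumFields.BalabanUV.T4Continuum.Support.NE7EffectiveFormGaugeFixedCoercive
import Summits.QuantumFields.BalabanUV.T4Continuum.Support.NE7BoxPoincareMatrix
import HarnessLib

/-!
# NE7EffectiveFormLandauSliceGap — THE TORUS POINCARÉ INEQUALITY TURNS THE GAUGE-FIXED COERCIVITY OF THE `(j+1)`-STEP EFFECTIVE FORM INTO A SPECTRAL GAP
# `c(N) = 2∕(N(N−1))` ON THE COARSE LANDAU SLICE MODULO CONSTANTS (`d = 4`, flat background, every level `j`, every volume `N`, every `U(n)`)

Lineage `b2b-balaban-t4-ne7b-p1` (row NE7b OWNER; junction service for row NE7), generation 160; item (P) of the road's memo `t4/b2b-balaban-t4-ne7-p1-g116/ROAD-G116.md` §6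
(«Poincaré on the torus for mean-zero Landau fields ⇒ spectral gap `c(N)` of `Δ_{j+1}` on the slice»).  Over ✓ `NE7EffectiveFormGaugeFixedCoercive` (gen 116 of the road:
`Σ‖∇ṽ‖² ≤ D²m_{j+1}(0)[v,v] + Σ‖δṽ‖²`, and on the Landau slice `Σ‖∇ṽ‖² ≤ D²m_{j+1}(0)[v,v]`) and the box Poincaré inequality for matrix fields ✓ `NE7BoxPoincareMatrix.poincare_periodBox_nhs`
(constant `m(m+1)∕2` on the box of side `m+1`, Dirichlet-box energy), whose box energy is trivially dominated by the full periodic gradient energy.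
WHAT ([folklore]; 0 def, 0 sorry):
* `poincare_periodBox_nhs_grad` (every `d`, `n`, `m`, every `η : ℤ^d → M_n(ℂ)`): `Σ_{x ∈ [0,m+1)^d} nhsNormSq (η x − η̄) ≤ (m(m+1)∕2)·Σ_{x ∈ [0,m+1)^d} Σ_μ nhsNormSq (η(x+e_μ) − η x)`,
  `η̄ = (m+1)^{−d}·Σ_{z} η z` — no periodicity hypothesis needed (the indicator of the box bonds is dropped).
* **`effectiveForm_add_divSq_poincare_flat_allLevels`** (`d = 4`, `L ≥ 2`, `0 < ε ≤ ε₀`, `N ≥ 1`, EVERY `j`, every `v ∈ skewSub 4 n N`):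
  `Σ_{x ∈ [0,N)^4} Σ_ν nhsNormSq (ṽ(x)_ν − v̄_ν) ≤ (N(N−1)∕2)·( D²(minAct_{j+1} ∘ chart_1)(0)[v,v] + Σ_{x ∈ [0,N)^4} nhsNormSq (Σ_μ (ṽ(x)_μ − ṽ(x−e_μ)_μ)) )`,
  `v̄_ν = N^{−4}·Σ_{z ∈ [0,N)^4} ṽ(z)_ν` — the mean-free `ℓ²`-mass of a coarse direction is controlled by the gauge-fixed effective form with the torus Poincaré constant.
* **`effectiveForm_landau_slice_gap_flat_allLevels`**: on the coarse LANDAU SLICE (`Σ_μ (ṽ(x)_μ − ṽ(x−e_μ)_μ) = 0`) `Σ_x Σ_ν nhsNormSq (ṽ(x)_ν − v̄_ν) ≤ (N(N−1)∕2)·D²(minAct_{j+1} ∘ chart_1)(0)[v,v]`;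
  **`effectiveForm_landau_meanZero_gap_flat_allLevels`**: if moreover `Σ_z ṽ(z)_ν = 0` for every `ν` (orthogonality to the constant zero modes) then
  `Σ_x Σ_ν nhsNormSq (ṽ(x)_ν) ≤ (N(N−1)∕2)·D²(minAct_{j+1} ∘ chart_1)(0)[v,v]` — the spectral gap `2∕(N(N−1))` of `Δ^{flat}_{j+1}` on (Landau slice) ∩ (constants)^⊥ in the `nhsNormSq` mass,
  uniformly in the level `j` and the colour number (the `N`-dependence is that of the torus Poincaré constant and is genuine: the zero modes are the constants, ✓ `NE7EffectiveFormFlatZeroModes`).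
HONEST FRAMING: flat datum; lower bounds only; OUR minimisers (B11 (8) with `sfClass`); nothing of Bałaban's asserted; NOT NE7 as a spine node; row NE7b (`T4WeightBudget.RelWeightBound`) NOT touched;
spine 0∕9; finite T⁴ rung (B)+1 — NOT infinite volume, NOT mass gap, NOT BetaPertH, NOT Clay.
-/

set_option autoImplicit false

open scoped BigOperators Matrix Matrix.Norms.L2Operator Topology
open NormedSpace Finset

namespace Summit.QuantumFields.BalabanUV.T4Continuum.NE7EffectiveFormLandauSliceGap

open Literature.MathematicalPhysics.QuantumFieldTheory.Balaban1983to89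
open B7Prop1Explicit B7Prop2Explicit
open T4AveragingDeficitWallBoundary (periodBox mem_periodBox)
open AveragingDeficitTorusChart (TDir chart chartDir)
open AveragingDeficitTwoLevelPrep (skewSub)
open MinimalActionSandwich (minAct)
open MinimalActionRate (sfClass)
open MinimalActionWitness (flatCfg)
open MatrixNorms (nhsNormSq nhsNormSq_nonneg)
open NE7BoxPoincareMatrix (poincare_periodBox_nhs)
open NE7EffectiveFormGaugeFixedCoercive (effectiveForm_add_divSq_ge_grad_flat_allLevels)

noncomputable section

variable {n : Type} [Fintype n] [DecidableEq n]

/-! ## §1 The torus∕box Poincaré inequality against the full gradient energy -/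

omit [DecidableEq n] in
/-- **POINCARÉ ON THE BOX AGAINST THE FULL GRADIENT ENERGY** (every `d`, `n`, `m`, every `η`): `Σ_{x ∈ [0,m+1)^d} nhsNormSq (η x − η̄) ≤ (m(m+1)∕2)·Σ_{x} Σ_μ nhsNormSq (η(x+e_μ) − η x)`,
`η̄ = (m+1)^{−d}·Σ_z η z` — ✓ `poincare_periodBox_nhs` with the box-bond indicator dropped (every dropped∕added term is non-negative). [folklore] -/
theorem poincare_periodBox_nhs_grad {d : ℕ} [Nonempty n] (m : ℕ) (η : Site d → Matrix n n ℂ) :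
    ∑ x ∈ periodBox (d := d) (m + 1), nhsNormSq (η x - (((m + 1 : ℕ) : ℂ) ^ d)⁻¹ • ∑ z ∈ periodBox (d := d) (m + 1), η z)
      ≤ (m : ℝ) * (m + 1) / 2 * ∑ x ∈ periodBox (d := d) (m + 1), ∑ μ : Fin d, nhsNormSq (η (x + e μ) - η x) := by
  refine (poincare_periodBox_nhs m η).trans (mul_le_mul_of_nonneg_left ?_ (by positivity))
  refine Finset.sum_le_sum fun x _ => Finset.sum_le_sum fun μ _ => ?_
  split_ifs
  · exact le_rfl
  · exact nhsNormSq_nonneg _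

omit [DecidableEq n] in
/-- The same with the box side written as `N ≥ 1` and the constant as `N(N−1)∕2`. [folklore] -/
theorem poincare_periodBox_nhs_grad' {d : ℕ} [Nonempty n] {N : ℕ} (hN : 1 ≤ N) (η : Site d → Matrix n n ℂ) :
    ∑ x ∈ periodBox (d := d) N, nhsNormSq (η x - (((N : ℕ) : ℂ) ^ d)⁻¹ • ∑ z ∈ periodBox (d := d) N, η z)
      ≤ (N : ℝ) * ((N : ℝ) - 1) / 2 * ∑ x ∈ periodBox (d := d) N, ∑ μ : Fin d, nhsNormSq (η (x + e μ) - η x) := by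
  obtain ⟨m, rfl⟩ : ∃ m, N = m + 1 := ⟨N - 1, by omega⟩
  have h := poincare_periodBox_nhs_grad (n := n) (d := d) m η
  have hc : ((m : ℝ) * (m + 1) / 2) = (((m + 1 : ℕ) : ℝ) * (((m + 1 : ℕ) : ℝ) - 1) / 2) := by push_cast; ring
  rw [hc] at h
  exact h

/-! ## §2 The effective form: Poincaré for the gauge-fixed form, the Landau-slice gap, the mean-zero gap -/

/-- **POINCARÉ FOR THE GAUGE-FIXED EFFECTIVE FORM** (`d = 4`, every `U(n)`, `L ≥ 2`): for `0 < ε ≤ ε₀`, `N ≥ 1`, every `j`, every `v ∈ skewSub 4 n N`,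
`Σ_{x ∈ [0,N)^4} Σ_ν nhsNormSq (ṽ(x)_ν − v̄_ν) ≤ (N(N−1)∕2)·( D²(minAct 4 (sfClass 4 L N ε) L N (j+1) ∘ chart_1)(0)[v,v] + Σ_x nhsNormSq (Σ_μ (ṽ(x)_μ − ṽ(x−e_μ)_μ)) )`,
`v̄_ν = N^{−4}·Σ_z ṽ(z)_ν`. [folklore] -/
theorem effectiveForm_add_divSq_poincare_flat_allLevels [Nonempty n] {L : ℕ} [NeZero L] (hL : 2 ≤ L) :
    ∃ ε₀ : ℝ, 0 < ε₀ ∧ ∀ ε : ℝ, 0 < ε → ε ≤ ε₀ → ∀ (N : ℕ) [NeZero N], 1 ≤ N → ∀ (j : ℕ) (v : ↥(skewSub 4 n N)),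
      ∑ x ∈ periodBox N, ∑ ν : Fin 4,
          nhsNormSq (chartDir (ContinuousLinearMap.id ℝ (Matrix n n ℂ)) N (v : TDir 4 n N) x ν
            - (((N : ℕ) : ℂ) ^ 4)⁻¹ • ∑ z ∈ periodBox N, chartDir (ContinuousLinearMap.id ℝ (Matrix n n ℂ)) N (v : TDir 4 n N) z ν)
        ≤ (N : ℝ) * ((N : ℝ) - 1) / 2 *
          (fderiv ℝ (fderiv ℝ (fun y : ↥(skewSub 4 n N) => minAct 4 (sfClass 4 L N ε) L N (j + 1)
              (chart (ContinuousLinearMap.id ℝ (Matrix n n ℂ)) N (flatCfg : Site 4 → Fin 4 → (Matrix n n ℂ)ˣ) (y : TDir 4 n N)))) 0 v v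
            + ∑ x ∈ periodBox N, nhsNormSq (∑ μ : Fin 4,
                (chartDir (ContinuousLinearMap.id ℝ (Matrix n n ℂ)) N (v : TDir 4 n N) x μ
                  - chartDir (ContinuousLinearMap.id ℝ (Matrix n n ℂ)) N (v : TDir 4 n N) (x - e μ) μ))) := by
  obtain ⟨ε₀, hε₀, H⟩ := effectiveForm_add_divSq_ge_grad_flat_allLevels (n := n) hL
  refine ⟨ε₀, hε₀, fun ε hε hεle N _ hN j v => ?_⟩
  have h := H ε hε hεle N hN j v
  set Y := chartDir (ContinuousLinearMap.id ℝ (Matrix n n ℂ)) N (v : TDir 4 n N) with hY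
  -- Poincaré componentwise, then swap the sums
  have hP : ∀ ν : Fin 4, ∑ x ∈ periodBox N, nhsNormSq (Y x ν - (((N : ℕ) : ℂ) ^ 4)⁻¹ • ∑ z ∈ periodBox N, Y z ν)
      ≤ (N : ℝ) * ((N : ℝ) - 1) / 2 * ∑ x ∈ periodBox N, ∑ μ : Fin 4, nhsNormSq (Y (x + e μ) ν - Y x ν) :=
    fun ν => poincare_periodBox_nhs_grad' (d := 4) hN (fun x => Y x ν)
  have hc : (0 : ℝ) ≤ (N : ℝ) * ((N : ℝ) - 1) / 2 := by
    have h1 : (1 : ℝ) ≤ N := by exact_mod_cast hN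
    have : (0 : ℝ) ≤ (N : ℝ) - 1 := by linarith
    positivity
  calc ∑ x ∈ periodBox N, ∑ ν : Fin 4, nhsNormSq (Y x ν - (((N : ℕ) : ℂ) ^ 4)⁻¹ • ∑ z ∈ periodBox N, Y z ν)
      = ∑ ν : Fin 4, ∑ x ∈ periodBox N, nhsNormSq (Y x ν - (((N : ℕ) : ℂ) ^ 4)⁻¹ • ∑ z ∈ periodBox N, Y z ν) := Finset.sum_comm
    _ ≤ ∑ ν : Fin 4, ((N : ℝ) * ((N : ℝ) - 1) / 2 * ∑ x ∈ periodBox N, ∑ μ : Fin 4, nhsNormSq (Y (x + e μ) ν - Y x ν)) :=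
        Finset.sum_le_sum fun ν _ => hP ν
    _ = (N : ℝ) * ((N : ℝ) - 1) / 2 * ∑ x ∈ periodBox N, ∑ μ : Fin 4, ∑ ν : Fin 4, nhsNormSq (Y (x + e μ) ν - Y x ν) := by
        rw [← Finset.mul_sum]
        congr 1
        rw [Finset.sum_comm]
        exact Finset.sum_congr rfl fun x _ => Finset.sum_comm
    _ ≤ (N : ℝ) * ((N : ℝ) - 1) / 2 * (fderiv ℝ (fderiv ℝ (fun y : ↥(skewSub 4 n N) => minAct 4 (sfClass 4 L N ε) L N (j + 1)
              (chart (ContinuousLinearMap.id ℝ (Matrix n n ℂ)) N (flatCfg : Site 4 → Fin 4 → (Matrix n n ℂ)ˣ) (y : TDir 4 n N)))) 0 v v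
            + ∑ x ∈ periodBox N, nhsNormSq (∑ μ : Fin 4, (Y x μ - Y (x - e μ) μ))) :=
        mul_le_mul_of_nonneg_left h hc

/-- **THE LANDAU-SLICE GAP MODULO CONSTANTS**: on the coarse Landau slice `Σ_μ (ṽ(x)_μ − ṽ(x−e_μ)_μ) = 0` (every site),
`Σ_{x ∈ [0,N)^4} Σ_ν nhsNormSq (ṽ(x)_ν − v̄_ν) ≤ (N(N−1)∕2)·D²(minAct_{j+1} ∘ chart_1)(0)[v,v]`, every `j`, `N ≥ 1`, `n`. [folklore] -/
theorem effectiveForm_landau_slice_gap_flat_allLevels [Nonempty n] {L : ℕ} [NeZero L] (hL : 2 ≤ L) :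
    ∃ ε₀ : ℝ, 0 < ε₀ ∧ ∀ ε : ℝ, 0 < ε → ε ≤ ε₀ → ∀ (N : ℕ) [NeZero N], 1 ≤ N → ∀ (j : ℕ) (v : ↥(skewSub 4 n N)),
      (∀ x : Site 4, ∑ μ : Fin 4,
          (chartDir (ContinuousLinearMap.id ℝ (Matrix n n ℂ)) N (v : TDir 4 n N) x μ
            - chartDir (ContinuousLinearMap.id ℝ (Matrix n n ℂ)) N (v : TDir 4 n N) (x - e μ) μ) = 0) →
      ∑ x ∈ periodBox N, ∑ ν : Fin 4,
          nhsNormSq (chartDir (ContinuousLinearMap.id ℝ (Matrix n n ℂ)) N (v : TDir 4 n N) x ν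
            - (((N : ℕ) : ℂ) ^ 4)⁻¹ • ∑ z ∈ periodBox N, chartDir (ContinuousLinearMap.id ℝ (Matrix n n ℂ)) N (v : TDir 4 n N) z ν)
        ≤ (N : ℝ) * ((N : ℝ) - 1) / 2 *
          fderiv ℝ (fderiv ℝ (fun y : ↥(skewSub 4 n N) => minAct 4 (sfClass 4 L N ε) L N (j + 1)
              (chart (ContinuousLinearMap.id ℝ (Matrix n n ℂ)) N (flatCfg : Site 4 → Fin 4 → (Matrix n n ℂ)ˣ) (y : TDir 4 n N)))) 0 v v := by
  obtain ⟨ε₀, hε₀, H⟩ := effectiveForm_add_divSq_poincare_flat_allLevels (n := n) hL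
  refine ⟨ε₀, hε₀, fun ε hε hεle N _ hN j v hdiv => ?_⟩
  have h := H ε hε hεle N hN j v
  have h0 : ∑ x ∈ periodBox N, nhsNormSq (∑ μ : Fin 4,
      (chartDir (ContinuousLinearMap.id ℝ (Matrix n n ℂ)) N (v : TDir 4 n N) x μ
        - chartDir (ContinuousLinearMap.id ℝ (Matrix n n ℂ)) N (v : TDir 4 n N) (x - e μ) μ)) = 0 :=
    Finset.sum_eq_zero fun x _ => by rw [hdiv x]; simp [nhsNormSq]
  rw [h0, add_zero] at h
  exact h

/-- **THE SPECTRAL GAP ON (LANDAU SLICE) ∩ (CONSTANTS)^⊥**: if `ṽ` is coarse-Landau and `Σ_{z ∈ [0,N)^4} ṽ(z)_ν = 0` for every `ν`, then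
`Σ_{x ∈ [0,N)^4} Σ_ν nhsNormSq (ṽ(x)_ν) ≤ (N(N−1)∕2)·D²(minAct_{j+1} ∘ chart_1)(0)[v,v]` — gap `2∕(N(N−1))`, every `j`, `N ≥ 1`, `n`. [folklore] -/
theorem effectiveForm_landau_meanZero_gap_flat_allLevels [Nonempty n] {L : ℕ} [NeZero L] (hL : 2 ≤ L) :
    ∃ ε₀ : ℝ, 0 < ε₀ ∧ ∀ ε : ℝ, 0 < ε → ε ≤ ε₀ → ∀ (N : ℕ) [NeZero N], 1 ≤ N → ∀ (j : ℕ) (v : ↥(skewSub 4 n N)),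
      (∀ x : Site 4, ∑ μ : Fin 4,
          (chartDir (ContinuousLinearMap.id ℝ (Matrix n n ℂ)) N (v : TDir 4 n N) x μ
            - chartDir (ContinuousLinearMap.id ℝ (Matrix n n ℂ)) N (v : TDir 4 n N) (x - e μ) μ) = 0) →
      (∀ ν : Fin 4, ∑ z ∈ periodBox N, chartDir (ContinuousLinearMap.id ℝ (Matrix n n ℂ)) N (v : TDir 4 n N) z ν = 0) →
      ∑ x ∈ periodBox N, ∑ ν : Fin 4, nhsNormSq (chartDir (ContinuousLinearMap.id ℝ (Matrix n n ℂ)) N (v : TDir 4 n N) x ν)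
        ≤ (N : ℝ) * ((N : ℝ) - 1) / 2 *
          fderiv ℝ (fderiv ℝ (fun y : ↥(skewSub 4 n N) => minAct 4 (sfClass 4 L N ε) L N (j + 1)
              (chart (ContinuousLinearMap.id ℝ (Matrix n n ℂ)) N (flatCfg : Site 4 → Fin 4 → (Matrix n n ℂ)ˣ) (y : TDir 4 n N)))) 0 v v := by
  obtain ⟨ε₀, hε₀, H⟩ := effectiveForm_landau_slice_gap_flat_allLevels (n := n) hL
  refine ⟨ε₀, hε₀, fun ε hε hεle N _ hN j v hdiv hmean => ?_⟩
  have h := H ε hε hεle N hN j v hdiv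
  simp only [hmean, smul_zero, sub_zero] at h
  exact h

end

end Summit.QuantumFields.BalabanUV.T4Continuum.NE7EffectiveFormLandauSliceGap
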